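import Summits.SmoothPoincare4.SmoothPoincare4.Theorems.ConvexBisectionAcyclicBisectionExistsBeltMonodromyChartsTransverse
import Summits.SmoothPoincare4.SmoothPoincare4.Theorems.ConvexBisectionAcyclicBisectionExistsBeltMonodromyBeltChart
import Summits.SmoothPoincare4.SmoothPoincare4.Theorems.ConvexBisectionAcyclicBisectionExistsSeamTwistSignLift
import HarnessLib

/-!
# N1 ▸ `node_N1_move` ▸ (d) N1-mono, brick H4-8: THE SEAM LIFT OF THE CHART FAMILY
# (the BELOW/SIDES part `Λ₀` of the two-sided fibred belt chart: smooth, fibred, immersive)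
(wave 7, crux stmt-SmoothPoincare4-10508, line `modp-braid-orbits`, registered stub `stub_M2geo` (N1) ▸
`node_N1_move` ▸ sub-node (d); registered sub-goal `helper_seamLiftChart`)

In the telescope of `node_N1_move` (`bX` on the ORIGINAL piece `X₀`, `G₀ : X₀ ≅ X`, data `D` of `X`), the input chart
family `φ` of (d) (`work/stubs/H4H7_interface.lean`, v5) is read on `∂X₀` through the seam as

    Λ₀ (p) := T (seamLift D (∂X) Ψ' (lift (φ p))),   Ψ' := Ψ ∘ T,  T := ∂(G₀⁻¹),  lift := (bBase g).inclInv

(X3's `seamLift` for the CANONICAL boundary datum of `X`; `…SeamTwistSignLift.lean`), defined wherever `φ p` is off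
the cores (`(r, σ) ≠ (0, 0)` in the box).  This file proves the clauses BELOW/SIDES/FIBRED/IMMERSION of (d) for
`Λ₀` (pieces (d5)/(d7) of H4-REPORT §4): `G₀ (bX.incl (Λ₀ p)) = D.jA (φ p)` (§1), `w (Ψ (Λ₀ p)) ∈ ℝ_{>0} d k e^{iσ}` (§1),
`Λ₀` is smooth at such `p` (§2) and its differential is injective there when `φ` is oriented at the level (H4-6:
`φ` is transverse to the pages; X3: `seamLift` is an immersion; `T` is a diffeomorphism) (§3).
Everything is proved; no named facts, no `sorry`.  References: A. A. Kosinski, *Differential Manifolds* (1993),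
VI §6 [Kosinski1993]; J. M. Lee, *Introduction to Smooth Manifolds* (2013), Thm. 5.11 [LeeSmoothManifolds2013].
-/

noncomputable section

set_option linter.dupNamespace false

open scoped Manifold ContDiff Topology
open Set Function Metric Complex
open Literature.Topology.FourManifolds Literature.Topology.FourManifolds.HandleAttachingMap
  Literature.Topology.FourManifolds.LefschetzBase

namespace Summit.SmoothPoincare4.SmoothPoincare4.Theorems.AcyclicBisectionExists.ModpBraidOrbits

variable {g n : ℕ} [Nonempty (bBase g).carrier] {h : Fin n → HandleAttachingMap 3 2 (Base g)}
  {X₀ : Type} [TopologicalSpace X₀] [ChartedSpace (EuclideanHalfSpace 4) X₀]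
  (bX : BoundaryData (𝓡∂ 4) X₀ (𝓡 3)) (Ψ : bX.carrier ≃ₘ⟮𝓡 3, 𝓡 3⟯ (bBase g).carrier)
  {X : Type} [TopologicalSpace X] [ChartedSpace (EuclideanHalfSpace 4) X] [IsManifold (𝓡∂ 4) ∞ X]
  [Nonempty (BoundaryManifold.boundaryData 3 X).carrier]
  (G₀ : X₀ ≃ₘ⟮𝓡∂ 4, 𝓡∂ 4⟯ X) (D : MultiAttachmentData h (𝓡∂ 4) X)

/-! ## §1 The seam lift of a boundary base point off the cores: value and page -/

/-- The lift of a boundary point of the base to the boundary datum `bBase g`. [folklore] -/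
theorem incl_inclInv_of_mem_page {c : ℂ} (hc : ‖c‖ = 1) {q : Base g} (hq : q ∈ page g c) :
    (bBase g).incl ((bBase g).inclInv q) = q :=
  (bBase g).incl_inclInv (page_subset_boundary g hc hq)

/-- **The seam lift over a boundary base point off the cores is read in `X` as that point**:
`G₀ (bX.incl (Λ₀ q)) = D.jA q`. [cite: Kosinski1993, VI §6] -/
theorem G₀_incl_seamLiftPt {c : ℂ} (hc : ‖c‖ = 1) {q : Base g} (hq : q ∈ page g c) (hoff : q ∈ coresComplement h) :
    G₀ (bX.incl ((BoundaryManifold.boundaryData 3 X).restrictDiffeomorph bX G₀.symm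
      (seamLift D (BoundaryManifold.boundaryData 3 X)
        (((BoundaryManifold.boundaryData 3 X).restrictDiffeomorph bX G₀.symm).trans Ψ) ((bBase g).inclInv q)))) =
      D.jA ⟨q, hoff⟩ := by
  have hy : (((bBase g).inclInv q).1 : Base g) ∈ coresComplement h := by
    have e : (((bBase g).inclInv q).1 : Base g) = q := incl_inclInv_of_mem_page hc hq
    rw [e]; exact hoff
  rw [G₀_incl_restrict, BoundaryManifold.boundaryData_incl]
  have h1 := incl_seamLift D (BoundaryManifold.boundaryData 3 X)
    (((BoundaryManifold.boundaryData 3 X).restrictDiffeomorph bX G₀.symm).trans Ψ) hy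
  rw [BoundaryManifold.boundaryData_incl] at h1
  rw [h1]
  congr 1
  apply Subtype.ext
  exact incl_inclInv_of_mem_page hc hq

/-- **The seam lift is fibred**: under the seam clause through `G₀`, `w (Ψ (Λ₀ q)) ∈ ℝ_{>0} · w q`.
[cite: Kosinski1993, VI §6] -/
theorem w_seamLiftPt
    (hseam : ∀ (y : bX.carrier) (a : ↥(coresComplement h)), G₀ (bX.incl y) = D.jA a →
      ∃ c : ℝ, 0 < c ∧ w g ((bBase g).incl (Ψ y)).1 = (c : ℂ) * w g (a : Base g).1)
    {c : ℂ} (hc : ‖c‖ = 1) {q : Base g} (hq : q ∈ page g c) (hoff : q ∈ coresComplement h) :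
    ∃ t : ℝ, 0 < t ∧ w g ((bBase g).incl (Ψ ((BoundaryManifold.boundaryData 3 X).restrictDiffeomorph bX G₀.symm
      (seamLift D (BoundaryManifold.boundaryData 3 X)
        (((BoundaryManifold.boundaryData 3 X).restrictDiffeomorph bX G₀.symm).trans Ψ) ((bBase g).inclInv q))))).1 =
      (t : ℂ) * (c / 2) := by
  obtain ⟨t, ht, hw⟩ := hseam _ ⟨q, hoff⟩ (G₀_incl_seamLiftPt bX Ψ G₀ D hc hq hoff)
  exact ⟨t, ht, by rw [hw]; exact congrArg _ hq.2⟩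

/-! ## §2 Smoothness of the seam lift of the chart family -/

/-- **The seam lift of the chart family is smooth** at every `p` whose level lies in `(−η₁, η₁)` and whose chart
point is off the cores. [cite: LeeSmoothManifolds2013, Thm. 5.11] -/
theorem contMDiffAt_seamLiftChart {c : ℂ} (hc : ‖c‖ = 1) {η₁ : ℝ} {φ : ℝ × ℝ × ℝ → Base g}
    (hφs : ContMDiff 𝓘(ℝ, ℝ × ℝ × ℝ) (𝓡∂ 4) ∞ φ)
    (hφp : ∀ u r σ, σ ∈ Icc (-η₁) η₁ → φ (u, r, σ) ∈ page g (c * Complex.exp ((σ : ℂ) * Complex.I)))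
    {p : ℝ × ℝ × ℝ} (hσ : p.2.2 ∈ Ioo (-η₁) η₁) (hoff : φ p ∈ coresComplement h) :
    ContMDiffAt 𝓘(ℝ, ℝ × ℝ × ℝ) (𝓡 3) ∞ (fun p' : ℝ × ℝ × ℝ =>
      (BoundaryManifold.boundaryData 3 X).restrictDiffeomorph bX G₀.symm
        (seamLift D (BoundaryManifold.boundaryData 3 X)
          (((BoundaryManifold.boundaryData 3 X).restrictDiffeomorph bX G₀.symm).trans Ψ) ((bBase g).inclInv (φ p')))) p := by
  -- the open set of parameters whose level is in `(−η₁, η₁)`: there `φ` lands in the boundary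
  set U : Set (ℝ × ℝ × ℝ) := {p' | p'.2.2 ∈ Ioo (-η₁) η₁} with hU
  have hUo : IsOpen U := isOpen_Ioo.preimage (continuous_snd.comp continuous_snd)
  have hpU : p ∈ U := hσ
  have hc' : ∀ σ : ℝ, ‖c * Complex.exp ((σ : ℂ) * Complex.I)‖ = 1 := fun σ => by
    rw [norm_mul, hc, Complex.norm_exp_ofReal_mul_I, mul_one]
  have hbdry : ∀ p' ∈ U, φ p' ∈ range (bBase g).incl := fun p' hp' => by
    rw [(bBase g).range_incl]
    exact page_subset_boundary g (hc' p'.2.2) (hφp p'.1 p'.2.1 p'.2.2 ⟨hp'.1.le, hp'.2.le⟩)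
  have h1 : ContMDiffOn 𝓘(ℝ, ℝ × ℝ × ℝ) (𝓡 3) ∞ (fun p' => (bBase g).inclInv (φ p')) U :=
    (bBase g).contMDiffOn_inclInv.comp hφs.contMDiffOn hbdry
  have h1' : ContMDiffAt 𝓘(ℝ, ℝ × ℝ × ℝ) (𝓡 3) ∞ (fun p' => (bBase g).inclInv (φ p')) p :=
    h1.contMDiffAt (hUo.mem_nhds hpU)
  have hy : ((((bBase g).inclInv (φ p))).1 : Base g) ∈ coresComplement h := by
    have e : (((bBase g).inclInv (φ p)).1 : Base g) = φ p :=
      (bBase g).incl_inclInv (by rw [← (bBase g).range_incl]; exact hbdry p hpU)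
    rw [e]; exact hoff
  have h2 := contMDiffAt_seamLift D (BoundaryManifold.boundaryData 3 X)
    (((BoundaryManifold.boundaryData 3 X).restrictDiffeomorph bX G₀.symm).trans Ψ) hy
  have h3 := ((BoundaryManifold.boundaryData 3 X).restrictDiffeomorph bX G₀.symm).contMDiff.contMDiffAt.comp _ h2
  have h4 := h3.comp p h1'
  exact h4

/-! ## §3 The seam lift of the chart family is an immersion -/

omit [Nonempty (bBase g).carrier] in
/-- **The differential of `φ` is injective where `p ↦ (φ p).1` has injective differential.** [folklore] -/
theorem injective_mfderiv_of_injective_fderiv_val {φ : ℝ × ℝ × ℝ → Base g}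
    (hφs : ContMDiff 𝓘(ℝ, ℝ × ℝ × ℝ) (𝓡∂ 4) ∞ φ) {p : ℝ × ℝ × ℝ}
    (hinj : Injective (fderiv ℝ (fun p' : ℝ × ℝ × ℝ => (φ p').1) p)) :
    Injective (mfderiv 𝓘(ℝ, ℝ × ℝ × ℝ) (𝓡∂ 4) φ p) := by
  have hφd : MDifferentiableAt 𝓘(ℝ, ℝ × ℝ × ℝ) (𝓡∂ 4) φ p := hφs.mdifferentiableAt (by simp)
  have hval : MDifferentiableAt (𝓡∂ 4) 𝓘(ℝ, EuclideanSpace ℝ (Fin 4)) (RegularSublevel.incl (isRegularLevel_rho g)) (φ p) :=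
    (RegularSublevel.contMDiff_incl (isRegularLevel_rho g)).mdifferentiableAt (by simp)
  have hcomp := mfderiv_comp p hval hφd
  have e : (RegularSublevel.incl (isRegularLevel_rho g) ∘ φ) = fun p' : ℝ × ℝ × ℝ => (φ p').1 := rfl
  rw [e] at hcomp
  intro v v' hvv
  apply hinj
  rw [← mfderiv_eq_fderiv, hcomp]
  show (mfderiv (𝓡∂ 4) 𝓘(ℝ, EuclideanSpace ℝ (Fin 4)) (RegularSublevel.incl (isRegularLevel_rho g)) (φ p))
      (mfderiv 𝓘(ℝ, ℝ × ℝ × ℝ) (𝓡∂ 4) φ p v) =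
    (mfderiv (𝓡∂ 4) 𝓘(ℝ, EuclideanSpace ℝ (Fin 4)) (RegularSublevel.incl (isRegularLevel_rho g)) (φ p))
      (mfderiv 𝓘(ℝ, ℝ × ℝ × ℝ) (𝓡∂ 4) φ p v')
  rw [hvv]

/-- **The lift of `φ` to the boundary datum is an immersion** where `φ` is (and lands in the boundary nearby).
[folklore] -/
theorem injective_mfderiv_inclInv_comp {φ : ℝ × ℝ × ℝ → Base g}
    (hφs : ContMDiff 𝓘(ℝ, ℝ × ℝ × ℝ) (𝓡∂ 4) ∞ φ) {U : Set (ℝ × ℝ × ℝ)} (hUo : IsOpen U) {p : ℝ × ℝ × ℝ} (hpU : p ∈ U)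
    (hbdry : ∀ p' ∈ U, φ p' ∈ range (bBase g).incl)
    (hinj : Injective (mfderiv 𝓘(ℝ, ℝ × ℝ × ℝ) (𝓡∂ 4) φ p)) :
    Injective (mfderiv 𝓘(ℝ, ℝ × ℝ × ℝ) (𝓡 3) (fun p' => (bBase g).inclInv (φ p')) p) := by
  have h1 : ContMDiffOn 𝓘(ℝ, ℝ × ℝ × ℝ) (𝓡 3) ∞ (fun p' => (bBase g).inclInv (φ p')) U :=
    (bBase g).contMDiffOn_inclInv.comp hφs.contMDiffOn hbdry
  have hld : MDifferentiableAt 𝓘(ℝ, ℝ × ℝ × ℝ) (𝓡 3) (fun p' => (bBase g).inclInv (φ p')) p :=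
    (h1.contMDiffAt (hUo.mem_nhds hpU)).mdifferentiableAt (by simp)
  have hid : MDifferentiableAt (𝓡 3) (𝓡∂ 4) (bBase g).incl ((bBase g).inclInv (φ p)) :=
    (bBase g).isSmoothEmbedding.contMDiff.mdifferentiableAt (by simp)
  have hcomp := mfderiv_comp p hid hld
  -- `incl ∘ (inclInv ∘ φ) = φ` near `p`
  have hev : ((bBase g).incl ∘ fun p' => (bBase g).inclInv (φ p')) =ᶠ[nhds p] φ := by
    filter_upwards [hUo.mem_nhds hpU] with p' hp'
    exact (bBase g).incl_inclInv (by rw [← (bBase g).range_incl]; exact hbdry p' hp')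
  rw [hev.mfderiv_eq] at hcomp
  intro v v' hvv
  apply hinj
  rw [hcomp]
  show (mfderiv (𝓡 3) (𝓡∂ 4) (bBase g).incl ((bBase g).inclInv (φ p)))
      (mfderiv 𝓘(ℝ, ℝ × ℝ × ℝ) (𝓡 3) (fun p' => (bBase g).inclInv (φ p')) p v) =
    (mfderiv (𝓡 3) (𝓡∂ 4) (bBase g).incl ((bBase g).inclInv (φ p)))
      (mfderiv 𝓘(ℝ, ℝ × ℝ × ℝ) (𝓡 3) (fun p' => (bBase g).inclInv (φ p')) p v')
  rw [hvv]

/-- **The seam lift of the chart family is an immersion** (brick H4-8): for the input `φ` of (d) (level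
`σ ⊂ page g (c e^{iσ})` for `|σ| ≤ η₁`, `‖c‖ = 1`), at every `p = (u, r, σ)` with `|σ| < η₁`, chart point off the cores
and `φ` oriented at the level `σ` at `(u, r)`, the differential of `Λ₀` at `p` is injective.
[cite: LeeSmoothManifolds2013, Thm. 5.11] -/
theorem injective_mfderiv_seamLiftChart {c : ℂ} (hc : ‖c‖ = 1) {η₁ : ℝ} {φ : ℝ × ℝ × ℝ → Base g}
    (hφs : ContMDiff 𝓘(ℝ, ℝ × ℝ × ℝ) (𝓡∂ 4) ∞ φ)
    (hφp : ∀ u r σ, σ ∈ Icc (-η₁) η₁ → φ (u, r, σ) ∈ page g (c * Complex.exp ((σ : ℂ) * Complex.I)))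
    {p : ℝ × ℝ × ℝ} (hσ : p.2.2 ∈ Ioo (-η₁) η₁) (hoff : φ p ∈ coresComplement h)
    (hφo : 0 < inner ℝ (deriv (fun r' => (φ (p.1, r', p.2.2)).1) p.2.1)
      (cplxJ (deriv (fun u' => (φ (u', p.2.1, p.2.2)).1) p.1))) :
    Injective (mfderiv 𝓘(ℝ, ℝ × ℝ × ℝ) (𝓡 3) (fun p' : ℝ × ℝ × ℝ =>
      (BoundaryManifold.boundaryData 3 X).restrictDiffeomorph bX G₀.symm
        (seamLift D (BoundaryManifold.boundaryData 3 X)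
          (((BoundaryManifold.boundaryData 3 X).restrictDiffeomorph bX G₀.symm).trans Ψ) ((bBase g).inclInv (φ p')))) p) := by
  set U : Set (ℝ × ℝ × ℝ) := {p' | p'.2.2 ∈ Ioo (-η₁) η₁} with hU
  have hUo : IsOpen U := isOpen_Ioo.preimage (continuous_snd.comp continuous_snd)
  have hpU : p ∈ U := hσ
  have hc' : ∀ σ : ℝ, ‖c * Complex.exp ((σ : ℂ) * Complex.I)‖ = 1 := fun σ => by
    rw [norm_mul, hc, Complex.norm_exp_ofReal_mul_I, mul_one]
  have hbdry : ∀ p' ∈ U, φ p' ∈ range (bBase g).incl := fun p' hp' => by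
    rw [(bBase g).range_incl]
    exact page_subset_boundary g (hc' p'.2.2) (hφp p'.1 p'.2.1 p'.2.2 ⟨hp'.1.le, hp'.2.le⟩)
  -- the three injective differentials
  have hF : Injective (fderiv ℝ (fun p' : ℝ × ℝ × ℝ => (φ p').1) p) := by
    have := chartFamily_fderiv_injective (u := p.1) (r := p.2.1) (σ := p.2.2) hc hφs hφp hσ hφo
    exact this
  have hφinj := injective_mfderiv_of_injective_fderiv_val hφs hF
  have hLinj := injective_mfderiv_inclInv_comp hφs hUo hpU hbdry hφinj
  have hy : ((((bBase g).inclInv (φ p))).1 : Base g) ∈ coresComplement h := by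
    have e : (((bBase g).inclInv (φ p)).1 : Base g) = φ p :=
      (bBase g).incl_inclInv (by rw [← (bBase g).range_incl]; exact hbdry p hpU)
    rw [e]; exact hoff
  have hSinj := injective_mfderiv_seamLift D (BoundaryManifold.boundaryData 3 X)
    (((BoundaryManifold.boundaryData 3 X).restrictDiffeomorph bX G₀.symm).trans Ψ) hy
  set T := (BoundaryManifold.boundaryData 3 X).restrictDiffeomorph bX G₀.symm with hT
  set S := seamLift D (BoundaryManifold.boundaryData 3 X)
    (((BoundaryManifold.boundaryData 3 X).restrictDiffeomorph bX G₀.symm).trans Ψ) with hS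
  set Lf : ℝ × ℝ × ℝ → (bBase g).carrier := fun p' => (bBase g).inclInv (φ p') with hLf
  -- differentiability
  have hLd : MDifferentiableAt 𝓘(ℝ, ℝ × ℝ × ℝ) (𝓡 3) Lf p :=
    (((bBase g).contMDiffOn_inclInv.comp hφs.contMDiffOn hbdry).contMDiffAt (hUo.mem_nhds hpU)).mdifferentiableAt (by simp)
  have hSd : MDifferentiableAt (𝓡 3) (𝓡 3) S (Lf p) :=
    (contMDiffAt_seamLift D _ _ hy).mdifferentiableAt (by simp)
  have hTd : MDifferentiableAt (𝓡 3) (𝓡 3) T (S (Lf p)) := T.contMDiff.mdifferentiableAt (by simp)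
  have e : (fun p' : ℝ × ℝ × ℝ => T (S ((bBase g).inclInv (φ p')))) = (T ∘ S) ∘ Lf := rfl
  rw [e, mfderiv_comp p (hTd.comp _ hSd) hLd, mfderiv_comp (Lf p) hTd hSd]
  have hTinj : Injective (mfderiv (𝓡 3) (𝓡 3) T (S (Lf p))) :=
    (T.mfderivToContinuousLinearEquiv (by simp) (S (Lf p))).injective
  exact (hTinj.comp hSinj).comp hLinj

/-- **The seam lift package** (brick H4-8).  THE SEAM LIFT `Λ₀` OF THE INPUT CHART FAMILY OF (d): in the telescope of
`node_N1_move` (seam clause through `G₀`), for the chart family `φ` (smooth, level `σ ⊂ page g (d k e^{iσ})` for `|σ| ≤ η₁`,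
oriented at every level) and every `p = (u, r, σ)` with `|r| < 1`, `|σ| < η₁` whose chart point is off the cores:
`G₀ (bX.incl (Λ₀ p)) = D.jA (φ p)` (BELOW/SIDES form), `w (Ψ (Λ₀ p)) ∈ ℝ_{>0} d k e^{iσ}` (FIBRED), `Λ₀` is smooth at `p` and
its differential at `p` is injective (IMMERSION). [cite: Kosinski1993, VI §6] -/
theorem seamLiftChart_package : ∀ (g n : ℕ) [Nonempty (Literature.Topology.FourManifolds.LefschetzBase.bBase g).carrier] (h : Fin n → Literature.Topology.FourManifolds.HandleAttachingMap 3 2 (Literature.Topology.FourManifolds.LefschetzBase.Base g)) (X₀ : Type) [TopologicalSpace X₀] [ChartedSpace (EuclideanHalfSpace 4) X₀] (bX : Literature.Topology.FourManifolds.BoundaryData (𝓡∂ 4) X₀ (𝓡 3)) (Ψ : bX.carrier ≃ₘ⟮𝓡 3, 𝓡 3⟯ (Literature.Topology.FourManifolds.LefschetzBase.bBase g).carrier) (X : Type) [TopologicalSpace X] [ChartedSpace (EuclideanHalfSpace 4) X] [IsManifold (𝓡∂ 4) ∞ X] [Nonempty (Literature.Topology.FourManifolds.BoundaryManifold.boundaryData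 3 X).carrier] (G₀ : X₀ ≃ₘ⟮𝓡∂ 4, 𝓡∂ 4⟯ X) (D : Literature.Topology.FourManifolds.HandleAttachingMap.MultiAttachmentData h (𝓡∂ 4) X) (d : Fin n → ℂ) (k : Fin n) (η₁ : ℝ) (φ : ℝ × ℝ × ℝ → Literature.Topology.FourManifolds.LefschetzBase.Base g), ‖d k‖ = 1 → (∀ (y : bX.carrier) (a : ↥(Literature.Topology.FourManifolds.HandleAttachingMap.coresComplement h)), G₀ (bX.incl y) = D.jA a → ∃ c : ℝ, 0 < c ∧ Literature.Topology.FourManifolds.LefschetzBase.w g ((Literature.Topology.FourManifolds.LefschetzBase.bBase g).incl (Ψ y)).1 = (c : ℂ) * Literature.Topology.FourManifolds.LefschetzBase.w g (a : Literature.Topology.FourManifolds.LefschetzBase.Base g).1) → ContMDiff 𝓘(ℝ, ℝ × ℝ × ℝ) (𝓡∂ 4) ∞ φ → (∀ u r σ, σ ∈ Set.Icc (-η₁) η₁ → φ (u, r, σ) ∈ Literature.Topology.FourManifolds.LefschetzBase.page g (d k * Complex.exp ((σ : ℂ) * Complex.I))) → (∀ u r σ, r ∈ Set.Ioo (-1 :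 ℝ) 1 → σ ∈ Set.Icc (-η₁) η₁ → 0 < inner ℝ (deriv (fun r' => (φ (u, r', σ)).1) r) (Literature.Topology.FourManifolds.LefschetzBase.cplxJ (deriv (fun u' => (φ (u', r, σ)).1) u))) → ∀ (u r σ : ℝ), r ∈ Set.Ioo (-1 : ℝ) 1 → σ ∈ Set.Ioo (-η₁) η₁ → ∀ (hoff : φ (u, r, σ) ∈ Literature.Topology.FourManifolds.HandleAttachingMap.coresComplement h), G₀ (bX.incl ((Literature.Topology.FourManifolds.BoundaryManifold.boundaryData 3 X).restrictDiffeomorph bX G₀.symm (Summit.SmoothPoincare4.SmoothPoincare4.Theorems.AcyclicBisectionExists.ModpBraidOrbits.seamLift D (Literature.Topology.FourManifolds.BoundaryManifold.boundaryData 3 X) (((Literature.Topology.FourManifolds.BoundaryManifold.boundaryData 3 X).restrictDiffeomorph bX G₀.symm).trans Ψ) ((Literature.Topology.FourManifolds.LefschetzBase.bBase g).inclInv (φ (u, r, σ)))))) = D.jA ⟨φ (u, r, σ), hoff⟩ ∧ (∃ t : ℝ, 0 < t ∧ Literature.Topology.FourManifolds.LefschetzBase.w g ((Literature.Topology.FourManifolds.LefschetzBase.bBase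 g).incl (Ψ ((Literature.Topology.FourManifolds.BoundaryManifold.boundaryData 3 X).restrictDiffeomorph bX G₀.symm (Summit.SmoothPoincare4.SmoothPoincare4.Theorems.AcyclicBisectionExists.ModpBraidOrbits.seamLift D (Literature.Topology.FourManifolds.BoundaryManifold.boundaryData 3 X) (((Literature.Topology.FourManifolds.BoundaryManifold.boundaryData 3 X).restrictDiffeomorph bX G₀.symm).trans Ψ) ((Literature.Topology.FourManifolds.LefschetzBase.bBase g).inclInv (φ (u, r, σ))))))).1 = (t : ℂ) * (d k * Complex.exp ((σ : ℂ) * Complex.I))) ∧ ContMDiffAt 𝓘(ℝ, ℝ × ℝ × ℝ) (𝓡 3) ∞ (fun p' : ℝ × ℝ × ℝ => (Literature.Topology.FourManifolds.BoundaryManifold.boundaryData 3 X).restrictDiffeomorph bX G₀.symm (Summit.SmoothPoincare4.SmoothPoincare4.Theorems.AcyclicBisectionExists.ModpBraidOrbits.seamLift D (Literature.Topology.FourManifolds.BoundaryManifold.boundaryData 3 X) (((Literature.Topology.FourManifolds.BoundaryManifold.boundaryData 3 X).restrictDiffeomorph bX G₀.symm).trans Ψ) ((Literature.Topology.FourManifolds.LefschetzBase.bBase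 g).inclInv (φ p')))) (u, r, σ) ∧ Function.Injective (mfderiv 𝓘(ℝ, ℝ × ℝ × ℝ) (𝓡 3) (fun p' : ℝ × ℝ × ℝ => (Literature.Topology.FourManifolds.BoundaryManifold.boundaryData 3 X).restrictDiffeomorph bX G₀.symm (Summit.SmoothPoincare4.SmoothPoincare4.Theorems.AcyclicBisectionExists.ModpBraidOrbits.seamLift D (Literature.Topology.FourManifolds.BoundaryManifold.boundaryData 3 X) (((Literature.Topology.FourManifolds.BoundaryManifold.boundaryData 3 X).restrictDiffeomorph bX G₀.symm).trans Ψ) ((Literature.Topology.FourManifolds.LefschetzBase.bBase g).inclInv (φ p')))) (u, r, σ)) := by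
  intro g n _ h X₀ _ _ bX Ψ X _ _ _ _ G₀ D d k η₁ φ hd hseam hφs hφp hφo u r σ hr hσ hoff
  have hσ' : σ ∈ Icc (-η₁) η₁ := ⟨hσ.1.le, hσ.2.le⟩
  have hc : ‖d k * Complex.exp ((σ : ℂ) * Complex.I)‖ = 1 := by
    rw [norm_mul, hd, Complex.norm_exp_ofReal_mul_I, mul_one]
  have hq := hφp u r σ hσ'
  refine ⟨G₀_incl_seamLiftPt bX Ψ G₀ D hc hq hoff, ?_, contMDiffAt_seamLiftChart bX Ψ G₀ D hd hφs hφp (p := (u, r, σ)) hσ hoff,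
    injective_mfderiv_seamLiftChart bX Ψ G₀ D hd hφs hφp (p := (u, r, σ)) hσ hoff (hφo u r σ hr hσ')⟩
  obtain ⟨t, ht, hw⟩ := w_seamLiftPt bX Ψ G₀ D hseam hc hq hoff
  exact ⟨t / 2, by positivity, by rw [hw]; push_cast; ring⟩

/-- **Sub-goal `helper_seamLiftChart` of stub `stub_M2geo`** (N1 ▸ `node_N1_move` ▸ (d) N1-mono, brick H4-8; wave 7, lead c5;
the registered packaging of `seamLiftChart_package` without the fibred clause).  The seam lift `Λ₀` of the input chart family
of (d) satisfies `G₀ (bX.incl (Λ₀ p)) = D.jA (φ p)`, is smooth at `p` and has injective differential at `p`, for every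
`p = (u, r, σ)` with `|r| < 1`, `|σ| < η₁` whose chart point is off the cores. [cite: Kosinski1993, VI §6] -/
theorem helper_seamLiftChart : ∀ (g n : ℕ) [Nonempty (Literature.Topology.FourManifolds.LefschetzBase.bBase g).carrier] (h : Fin n → Literature.Topology.FourManifolds.HandleAttachingMap 3 2 (Literature.Topology.FourManifolds.LefschetzBase.Base g)) (X₀ : Type) [TopologicalSpace X₀] [ChartedSpace (EuclideanHalfSpace 4) X₀] (bX : Literature.Topology.FourManifolds.BoundaryData (𝓡∂ 4) X₀ (𝓡 3)) (Ψ : bX.carrier ≃ₘ⟮𝓡 3, 𝓡 3⟯ (Literature.Topology.FourManifolds.LefschetzBase.bBase g).carrier) (X : Type) [TopologicalSpace X] [ChartedSpace (EuclideanHalfSpace 4) X] [IsManifold (𝓡∂ 4) ∞ X] [Nonempty (Literature.Topology.FourManifolds.BoundaryManifold.boundaryData 3 X).carrier] (G₀ : X₀ ≃ₘ⟮𝓡∂ 4, 𝓡∂ 4⟯ X) (D : Literature.Topology.FourManifolds.HandleAttachingMap.MultiAttachmentData h (𝓡∂ 4) X) (d : Fin n → ℂ) (k : Fin n) (η₁ :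 ℝ) (φ : ℝ × ℝ × ℝ → Literature.Topology.FourManifolds.LefschetzBase.Base g), ‖d k‖ = 1 → ContMDiff 𝓘(ℝ, ℝ × ℝ × ℝ) (𝓡∂ 4) ∞ φ → (∀ u r σ, σ ∈ Set.Icc (-η₁) η₁ → φ (u, r, σ) ∈ Literature.Topology.FourManifolds.LefschetzBase.page g (d k * Complex.exp ((σ : ℂ) * Complex.I))) → (∀ u r σ, r ∈ Set.Ioo (-1 : ℝ) 1 → σ ∈ Set.Icc (-η₁) η₁ → 0 < inner ℝ (deriv (fun r' => (φ (u, r', σ)).1) r) (Literature.Topology.FourManifolds.LefschetzBase.cplxJ (deriv (fun u' => (φ (u', r, σ)).1) u))) → ∀ (u r σ : ℝ), r ∈ Set.Ioo (-1 : ℝ) 1 → σ ∈ Set.Ioo (-η₁) η₁ → ∀ (hoff : φ (u, r, σ) ∈ Literature.Topology.FourManifolds.HandleAttachingMap.coresComplement h), G₀ (bX.incl ((Literature.Topology.FourManifolds.BoundaryManifold.boundaryData 3 X).restrictDiffeomorph bX G₀.symm (Summit.SmoothPoincare4.SmoothPoincare4.Theorems.AcyclicBisectionExists.ModpBraidOrbits.seamLift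 D (Literature.Topology.FourManifolds.BoundaryManifold.boundaryData 3 X) (((Literature.Topology.FourManifolds.BoundaryManifold.boundaryData 3 X).restrictDiffeomorph bX G₀.symm).trans Ψ) ((Literature.Topology.FourManifolds.LefschetzBase.bBase g).inclInv (φ (u, r, σ)))))) = D.jA ⟨φ (u, r, σ), hoff⟩ ∧ ContMDiffAt 𝓘(ℝ, ℝ × ℝ × ℝ) (𝓡 3) ∞ (fun p' : ℝ × ℝ × ℝ => (Literature.Topology.FourManifolds.BoundaryManifold.boundaryData 3 X).restrictDiffeomorph bX G₀.symm (Summit.SmoothPoincare4.SmoothPoincare4.Theorems.AcyclicBisectionExists.ModpBraidOrbits.seamLift D (Literature.Topology.FourManifolds.BoundaryManifold.boundaryData 3 X) (((Literature.Topology.FourManifolds.BoundaryManifold.boundaryData 3 X).restrictDiffeomorph bX G₀.symm).trans Ψ) ((Literature.Topology.FourManifolds.LefschetzBase.bBase g).inclInv (φ p')))) (u, r, σ) ∧ Function.Injective (mfderiv 𝓘(ℝ, ℝ × ℝ × ℝ) (𝓡 3) (fun p' : ℝ × ℝ × ℝ => (Literature.Topology.FourManifolds.BoundaryManifold.boundaryData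 3 X).restrictDiffeomorph bX G₀.symm (Summit.SmoothPoincare4.SmoothPoincare4.Theorems.AcyclicBisectionExists.ModpBraidOrbits.seamLift D (Literature.Topology.FourManifolds.BoundaryManifold.boundaryData 3 X) (((Literature.Topology.FourManifolds.BoundaryManifold.boundaryData 3 X).restrictDiffeomorph bX G₀.symm).trans Ψ) ((Literature.Topology.FourManifolds.LefschetzBase.bBase g).inclInv (φ p')))) (u, r, σ)) := by
  intro g n _ h X₀ _ _ bX Ψ X _ _ _ _ G₀ D d k η₁ φ hd hφs hφp hφo u r σ hr hσ hoff
  have hσ' : σ ∈ Icc (-η₁) η₁ := ⟨hσ.1.le, hσ.2.le⟩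
  have hc : ‖d k * Complex.exp ((σ : ℂ) * Complex.I)‖ = 1 := by
    rw [norm_mul, hd, Complex.norm_exp_ofReal_mul_I, mul_one]
  exact ⟨G₀_incl_seamLiftPt bX Ψ G₀ D hc (hφp u r σ hσ') hoff, contMDiffAt_seamLiftChart bX Ψ G₀ D hd hφs hφp (p := (u, r, σ)) hσ hoff,
    injective_mfderiv_seamLiftChart bX Ψ G₀ D hd hφs hφp (p := (u, r, σ)) hσ hoff (hφo u r σ hr hσ')⟩

end Summit.SmoothPoincare4.SmoothPoincare4.Theorems.AcyclicBisectionExists.ModpBraidOrbits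

end
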